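import Summits.QuantumAdvantage.QuantumAdvantage.Theorems.LinnikCubicClassGroupsDegreeOnePrimesEscapeRayClassShortInterval
import Summits.QuantumAdvantage.QuantumAdvantage.Theorems.LinnikCubicClassGroupsDegreeOnePrimesEscapeRayClassDegOne
import HarnessLib

/-!
# Linnik's theorem for cosets of a congruence class group, XV: DEGREE-ONE prime ideals of every coset in every short
# interval

Topic `Summits/QuantumAdvantage/QuantumAdvantage/Theorems`, cell B2b-1 (linnik-cubic), PART A (gen 25); helper toward
the crux `DegreeOnePrimesEscape` (stmt-QuantumAdvantage-11543) of route `LinnikCubicClassGroups`.  HONEST FRAMING: the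
value of this file is a THEOREM (kernel-checked, GRH-free, Siegel-free) — NOT summit progress (the route still rests on
the hypothesis-type target `PureCubicClassNumberHard`).

For a number field `K` of degree `n > 1` and an abelian Frobenius datum `f : 𝔭 ↦ f 𝔭 ∈ G` killing the narrow ray
`mod 𝔪 ≠ 0`, with non-trivial characters non-principal off `𝔪` and `|G| ≤ Q_𝔪⁴` (`Q_𝔪 = |d_K| n^n N𝔪`):
* `exists_degOnePrime_of_fiberTheta_sub_gt` — if `θ_τ(y) − θ_τ(x) > n(√y + 1) log y` then the coset `τ` contains a
  prime `𝔭 ∤ 𝔪` of RESIDUE DEGREE ONE with `x < N𝔭 ≤ y` (at most `n(√y+1)` primes of norm `≤ y` have degree `≥ 2`,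
  file VIII `card_filter_primeIdealsLE_not_prime_le`);
* `exists_degOnePrime_fiber_absNorm_mem_Ioc` — **Hoheisel–Linnik with degree-one primes**: there are `δ = δ(n) > 0`,
  `L = L(n) > 0` such that every coset `τ` contains a prime `𝔭 ∤ 𝔪` whose norm is a RATIONAL PRIME `p` with
  `x < p ≤ x + h`, for every `x ≥ Q_𝔪^L` and `x^{1−δ} ≤ h ≤ x` (file XI gave a prime ideal of unspecified degree; the
  lower bound `|G| Δψ_τ ≥ c₂ Q_𝔪^{−8} h` of `fiberPsi_shortInterval_lower` absorbs both the prime powers and the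
  primes of degree `≥ 2`, each `≪ n Q_𝔪⁴ √x log x`);
* `exists_degOnePrime_rayClass_absNorm_mem_Ioc` — the canonical case, UNCONDITIONAL: **every narrow ray class `mod 𝔪`
  of every number field of degree `n` contains a degree-one prime `𝔭 ∤ 𝔪` with `x < N𝔭 ≤ x + h`** for all
  `x ≥ (|d_K| n^n N𝔪)^L`, `x^{1−δ} ≤ h ≤ x`.
References: [LagariasMontgomeryOdlyzko1979] §7; [Weiss1983] §6; A. Balog, K. Ono, The Chebotarev density theorem in
short intervals and some questions of Serre, J. Number Theory 91 (2001) (fixed field).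
-/

noncomputable section

open Complex Real Set Filter Topology NumberField IsDedekindDomain
open scoped NumberField nonZeroDivisors

namespace Summit.QuantumAdvantage.QuantumAdvantage.Theorems.DegreeOnePrimesEscape

open Literature.NumberTheory.LFunctions Literature.NumberTheory.LFunctions.NumberField
  Literature.NumberTheory.LFunctions.AbelianDensity Literature.NumberTheory.GaloisRepresentations
open scoped Classical

/-! ### From a `θ`-increment exceeding the degree-`≥ 2` junk to a degree-one prime -/

section Window

variable {K : Type} [Field K] [NumberField K]
variable {G : Type} [CommGroup G] {𝔪 : Ideal (𝓞 K)} {f : HeightOneSpectrum (𝓞 K) → G}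

/-- **A degree-one prime in the window from `θ_τ(y) − θ_τ(x) > n(√y+1) log y`** (`0 ≤ x ≤ y`, `1 ≤ y`): the
primes `P` of norm in `(x, y]` whose norm is not a rational prime contribute at most
`#{N P ≤ y, N P not prime} · log y ≤ n(√y + 1) log y` to the increment. -/
theorem exists_degOnePrime_of_fiberTheta_sub_gt (τ : G) {x y : ℝ} (hx : 0 ≤ x) (hxy : x ≤ y) (hy1 : 1 ≤ y)
    (hθ : (Module.finrank ℚ K : ℝ) * (Real.sqrt y + 1) * Real.log y <
      fiberTheta 𝔪 f τ y - fiberTheta 𝔪 f τ x) :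
    ∃ v : HeightOneSpectrum (𝓞 K), ¬ 𝔪 ≤ v.asIdeal ∧ f v = τ ∧ (Ideal.absNorm v.asIdeal).Prime ∧
      x < (Ideal.absNorm v.asIdeal : ℝ) ∧ (Ideal.absNorm v.asIdeal : ℝ) ≤ y := by
  have hy0 : 0 ≤ y := hx.trans hxy
  have hlogy : 0 ≤ Real.log y := Real.log_nonneg hy1
  set Ty := (finite_primeIdealsLE K y).toFinset with hTy
  set Tx := (finite_primeIdealsLE K x).toFinset with hTx
  have hsub : Tx ⊆ Ty := by
    intro P hP
    rw [hTx, mem_primeIdealsLE_toFinset] at hP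
    rw [hTy, mem_primeIdealsLE_toFinset]
    exact ⟨hP.1, hP.2.1, hP.2.2.trans hxy⟩
  set g : Ideal (𝓞 K) → ℝ := fun P ↦ fiberIndicatorIdeal 𝔪 f τ P * Real.log (Ideal.absNorm P) with hg
  have hdiff : fiberTheta 𝔪 f τ y - fiberTheta 𝔪 f τ x = ∑ P ∈ Ty \ Tx, g P := by
    unfold fiberTheta
    rw [← hTy, ← hTx, ← Finset.sum_sdiff hsub]; ring
  have hsplit : ∑ P ∈ Ty \ Tx, g P =
      ∑ P ∈ (Ty \ Tx).filter (fun P ↦ (Ideal.absNorm P).Prime), g P +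
        ∑ P ∈ (Ty \ Tx).filter (fun P ↦ ¬ (Ideal.absNorm P).Prime), g P :=
    (Finset.sum_filter_add_sum_filter_not _ _ _).symm
  -- the terms are `≤ log y`
  have hterm : ∀ P ∈ Ty \ Tx, g P ≤ Real.log y := by
    intro P hP
    rw [Finset.mem_sdiff, hTy, mem_primeIdealsLE_toFinset] at hP
    obtain ⟨⟨_, hP0, hle⟩, _⟩ := hP
    have hN1 : (1 : ℝ) ≤ (Ideal.absNorm P : ℝ) := by
      have h0 : Ideal.absNorm P ≠ 0 := by rw [Ne, Ideal.absNorm_eq_zero_iff]; exact hP0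
      exact_mod_cast Nat.one_le_iff_ne_zero.mpr h0
    have hind := fiberIndicatorIdeal_mem (𝔪 := 𝔪) (f := f) τ P
    calc g P = fiberIndicatorIdeal 𝔪 f τ P * Real.log (Ideal.absNorm P) := rfl
      _ ≤ 1 * Real.log y :=
          mul_le_mul hind.2 (Real.log_le_log (by linarith) hle) (Real.log_nonneg hN1) zero_le_one
      _ = Real.log y := one_mul _
  -- the non-degree-one part is at most `n(√y+1) log y`
  have hjunk : ∑ P ∈ (Ty \ Tx).filter (fun P ↦ ¬ (Ideal.absNorm P).Prime), g P ≤
      (Module.finrank ℚ K : ℝ) * (Real.sqrt y + 1) * Real.log y := by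
    have h1 : ∑ P ∈ (Ty \ Tx).filter (fun P ↦ ¬ (Ideal.absNorm P).Prime), g P ≤
        (((Ty \ Tx).filter (fun P ↦ ¬ (Ideal.absNorm P).Prime)).card : ℝ) * Real.log y := by
      have h := Finset.sum_le_card_nsmul ((Ty \ Tx).filter (fun P ↦ ¬ (Ideal.absNorm P).Prime)) g (Real.log y)
        (fun P hP ↦ hterm P (Finset.mem_filter.mp hP).1)
      rwa [nsmul_eq_mul] at h
    have h2 : (((Ty \ Tx).filter (fun P ↦ ¬ (Ideal.absNorm P).Prime)).card : ℝ) ≤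
        ((Ty.filter (fun P ↦ ¬ (Ideal.absNorm P).Prime)).card : ℝ) := by
      exact_mod_cast Finset.card_le_card (Finset.filter_subset_filter _ Finset.sdiff_subset)
    have h3 := card_filter_primeIdealsLE_not_prime_le (K := K) hy0
    rw [← hTy] at h3
    calc _ ≤ (((Ty \ Tx).filter (fun P ↦ ¬ (Ideal.absNorm P).Prime)).card : ℝ) * Real.log y := h1
      _ ≤ ((Ty.filter (fun P ↦ ¬ (Ideal.absNorm P).Prime)).card : ℝ) * Real.log y :=
          mul_le_mul_of_nonneg_right h2 hlogy
      _ ≤ (Module.finrank ℚ K : ℝ) * (Real.sqrt y + 1) * Real.log y := mul_le_mul_of_nonneg_right h3 hlogy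
  -- hence the degree-one part is positive and has a nonzero term
  have hpos : 0 < ∑ P ∈ (Ty \ Tx).filter (fun P ↦ (Ideal.absNorm P).Prime), g P := by
    rw [hdiff, hsplit] at hθ; linarith
  obtain ⟨P, hPmem, hne⟩ := Finset.exists_ne_zero_of_sum_ne_zero hpos.ne'
  rw [Finset.mem_filter, Finset.mem_sdiff, hTy, hTx, mem_primeIdealsLE_toFinset, mem_primeIdealsLE_toFinset] at hPmem
  obtain ⟨⟨⟨hprime, hP0, hle⟩, hnot⟩, hNp⟩ := hPmem
  have hind : P ≠ ⊥ ∧ IsCoprime P 𝔪 ∧ artinSymbol f P = τ := by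
    by_contra h
    apply hne
    show fiberIndicatorIdeal 𝔪 f τ P * Real.log (Ideal.absNorm P) = 0
    unfold fiberIndicatorIdeal; rw [if_neg h, zero_mul]
  have hgt : x < (Ideal.absNorm P : ℝ) := by
    by_contra hle'
    exact hnot ⟨hprime, hP0, not_lt.1 hle'⟩
  set v : HeightOneSpectrum (𝓞 K) := ⟨P, hprime, hP0⟩ with hv
  refine ⟨v, fun hm ↦ ?_, ?_, hNp, hgt, hle⟩
  · have h := hind.2.1
    rw [Ideal.isCoprime_iff_sup_eq, sup_eq_left.2 hm] at h
    exact hprime.ne_top h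
  · have := artinSymbol_asIdeal f v
    rw [hv] at this; dsimp only at this
    rw [← this]; exact hind.2.2

end Window

/-! ### Hoheisel–Linnik with degree-one primes -/

set_option maxHeartbeats 1600000 in
/-- **Hoheisel–Linnik for the cosets of a congruence class group, DEGREE-ONE primes** (see the module docstring): for
`n > 1` there are `δ, L > 0` such that for every `K` of degree `n`, every datum as above with `|G| ≤ Q_𝔪⁴`, every coset
`τ`, every `x ≥ Q_𝔪^L` and every `x^{1−δ} ≤ h ≤ x` there is a prime `𝔭 ∤ 𝔪` with `f 𝔭 = τ`, `N𝔭` a rational prime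
and `x < N𝔭 ≤ x + h` — unconditionally. [cite: LagariasMontgomeryOdlyzko1979, §7] [cite: Weiss1983, §6] -/
theorem exists_degOnePrime_fiber_absNorm_mem_Ioc (n : ℕ) (hn : 1 < n) :
    ∃ δ L : ℝ, 0 < δ ∧ 0 < L ∧ ∀ (K : Type) [Field K] [NumberField K], Module.finrank ℚ K = n →
    ∀ (G : Type) [CommGroup G] [Finite G] (𝔪 : Ideal (𝓞 K)) (f : HeightOneSpectrum (𝓞 K) → G),
      𝔪 ≠ ⊥ → ArtinKillsRay 𝔪 f →
      (∀ χ : AddChar (Additive G) ℂ, χ ≠ 0 →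
        ∃ v : HeightOneSpectrum (𝓞 K), ¬ 𝔪 ≤ v.asIdeal ∧ χ (Additive.ofMul (f v)) ≠ 1) →
      (Nat.card G : ℝ) ≤ rayCondQ K 𝔪 ^ (4 : ℕ) →
      ∀ x h : ℝ, rayCondQ K 𝔪 ^ L ≤ x → x ^ (1 - δ) ≤ h → h ≤ x → ∀ τ : G,
        ∃ v : HeightOneSpectrum (𝓞 K), ¬ 𝔪 ≤ v.asIdeal ∧ f v = τ ∧ (Ideal.absNorm v.asIdeal).Prime ∧
          x < (Ideal.absNorm v.asIdeal : ℝ) ∧ (Ideal.absNorm v.asIdeal : ℝ) ≤ x + h := by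
  obtain ⟨δ, a, c₂, hδ, hδ64, ha, hc₂, hc₂1, hmain⟩ := fiberPsi_shortInterval_lower n hn
  obtain ⟨a₂, ha₂, habs⟩ := absorb_junk (16 / c₂) 1 (by positivity) one_pos le_rfl
  refine ⟨δ, max (4 * a) (2 * a₂), hδ, by positivity, fun K _ _ hKn G _ _ 𝔪 f h𝔪 hray hsep hG x h hx hhx hhx' τ ↦ ?_⟩
  have hK : 1 < Module.finrank ℚ K := by rw [hKn]; exact hn
  set R : ℝ := rayCondQ K 𝔪 with hR
  have hR12 : (12 : ℝ) ≤ R := twelve_le_rayCondQ hK h𝔪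
  have hR1 : (1 : ℝ) ≤ R := by linarith
  have hR0 : (0 : ℝ) < R := by linarith
  -- thresholds: `(R⁴)^a ≤ x` and `(R²)^{a₂} ≤ x`
  have hx4a : (R ^ (4 : ℕ)) ^ a ≤ x := by
    refine le_trans ?_ hx
    rw [← Real.rpow_natCast, ← Real.rpow_mul hR0.le]
    exact Real.rpow_le_rpow_of_exponent_le hR1 (by push_cast; linarith [le_max_left (4 * a) (2 * a₂)])
  have hx2a : (R ^ (2 : ℕ)) ^ a₂ ≤ x := by
    refine le_trans ?_ hx
    rw [← Real.rpow_natCast, ← Real.rpow_mul hR0.le]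
    exact Real.rpow_le_rpow_of_exponent_le hR1 (by push_cast; linarith [le_max_right (4 * a) (2 * a₂)])
  have hR2_12 : (12 : ℝ) ≤ R ^ (2 : ℕ) := by nlinarith
  have hxR : R ≤ x := by
    have h1 : R ^ (1 : ℝ) ≤ R ^ max (4 * a) (2 * a₂) :=
      Real.rpow_le_rpow_of_exponent_le hR1 (by linarith [le_max_left (4 * a) (2 * a₂)])
    rw [Real.rpow_one] at h1; exact h1.trans hx
  have hx1 : 1 ≤ x := by linarith
  have hx0 : 0 < x := by linarith
  have hh0 : 0 < h := lt_of_lt_of_le (Real.rpow_pos_of_pos hx0 _) hhx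
  have hlow := hmain K hKn G 𝔪 f h𝔪 hray hsep hG x h hx4a hhx hhx' τ
  have hG0 : (0 : ℝ) ≤ (Nat.card G : ℝ) := Nat.cast_nonneg _
  have hnR : (Module.finrank ℚ K : ℝ) ≤ R :=
    (ThornerZaman.finrank_le_condQn (K := K)).trans (condQn_le_rayCondQ h𝔪)
  -- the prime powers: `(ψ_τ − θ_τ)(x+h) ≤ 2n √(x+h) log(x+h)`
  have hpp : fiberPsi 𝔪 f τ (x + h) - fiberTheta 𝔪 f τ (x + h) ≤
      2 * Module.finrank ℚ K * Real.sqrt (x + h) * Real.log (x + h) := by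
    refine (fiberPsi_sub_fiberTheta_le τ (by linarith : (0 : ℝ) ≤ x + h)).trans ?_
    refine (chebyshevPsiIdeal_sub_chebyshevThetaIdeal_le K (by linarith : (1 : ℝ) ≤ x + h)).trans ?_
    exact mul_le_mul_of_nonneg_right (primeIdealCount_le_two_mul_finrank_mul K (Real.sqrt_nonneg _))
      (Real.log_nonneg (by linarith))
  have hθψ : fiberTheta 𝔪 f τ x ≤ fiberPsi 𝔪 f τ x := fiberTheta_le_fiberPsi τ x
  -- the degree-`≥ 2` junk: `n(√(x+h) + 1) log(x+h) ≤ 2n √(x+h) log(x+h)`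
  have hsq1 : 1 ≤ Real.sqrt (x + h) := by
    rw [← Real.sqrt_one]; exact Real.sqrt_le_sqrt (by linarith)
  have hlog0 : 0 ≤ Real.log (x + h) := Real.log_nonneg (by linarith)
  have hdeg : (Module.finrank ℚ K : ℝ) * (Real.sqrt (x + h) + 1) * Real.log (x + h) ≤
      2 * Module.finrank ℚ K * Real.sqrt (x + h) * Real.log (x + h) := by
    have hn0 : (0 : ℝ) ≤ Module.finrank ℚ K := Nat.cast_nonneg _
    have : (Module.finrank ℚ K : ℝ) * (Real.sqrt (x + h) + 1) ≤ 2 * Module.finrank ℚ K * Real.sqrt (x + h) := by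
      nlinarith
    exact mul_le_mul_of_nonneg_right this hlog0
  -- `2 |G| n √(x+h) log(x+h) ≤ (c₂/4) R^{-8} h`
  have hsqrt : Real.sqrt (x + h) ≤ 2 * x ^ ((1 : ℝ) / 2) := by
    rw [Real.sqrt_eq_rpow]
    have h1 : (x + h) ^ ((1 : ℝ) / 2) ≤ (4 * x) ^ ((1 : ℝ) / 2) :=
      Real.rpow_le_rpow (by linarith) (by linarith) (by norm_num)
    have h2 : (4 * x) ^ ((1 : ℝ) / 2) = 2 * x ^ ((1 : ℝ) / 2) := by
      rw [Real.mul_rpow (by norm_num) hx0.le]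
      congr 1
      rw [show (4 : ℝ) = 2 ^ (2 : ℕ) by norm_num, ← Real.rpow_natCast, ← Real.rpow_mul (by norm_num)]
      norm_num
    linarith
  have hlogxh : Real.log (x + h) ≤ Real.log x + 1 := by
    have h1 : Real.log (x + h) ≤ Real.log (2 * x) := Real.log_le_log (by linarith) (by linarith)
    rw [Real.log_mul (by norm_num) hx0.ne'] at h1
    have h2 : Real.log 2 < 0.6931471808 := Real.log_two_lt_d9
    linarith
  have hl1 : 0 ≤ Real.log x + 1 := by have := Real.log_nonneg hx1; linarith
  have habs' := habs (R ^ (2 : ℕ)) x hR2_12 hx2a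
  have hx34 : x ^ ((1 : ℝ) / 2) = x ^ (-((1 : ℝ) / 4)) * x ^ ((3 : ℝ) / 4) := by
    rw [← Real.rpow_add hx0]; norm_num
  have hx34h : x ^ ((3 : ℝ) / 4) ≤ h := (Real.rpow_le_rpow_of_exponent_le hx1 (by linarith)).trans hhx
  have hRm8 : 0 < R ^ (-(8 : ℝ)) := Real.rpow_pos_of_pos hR0 _
  have hR13 : R ^ (13 : ℕ) ≤ (R ^ (2 : ℕ)) ^ (7 : ℕ) := by
    rw [← pow_mul]; exact pow_le_pow_right₀ hR1 (by norm_num)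
  have hR5 : R ^ (5 : ℕ) = R ^ (13 : ℕ) * R ^ (-(8 : ℝ)) := by
    rw [show (R ^ (13 : ℕ) : ℝ) = R ^ (13 : ℝ) from (Real.rpow_natCast R 13).symm, ← Real.rpow_add hR0,
      show (R ^ (5 : ℕ) : ℝ) = R ^ (5 : ℝ) from (Real.rpow_natCast R 5).symm]
    norm_num
  have hA : 4 * R ^ (13 : ℕ) * (Real.log x + 1) * x ^ ((1 : ℝ) / 2) ≤ c₂ / 4 * h := by
    rw [hx34]
    calc 4 * R ^ (13 : ℕ) * (Real.log x + 1) * (x ^ (-((1 : ℝ) / 4)) * x ^ ((3 : ℝ) / 4))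
        ≤ 4 * (R ^ (2 : ℕ)) ^ (7 : ℕ) * (Real.log x + 1) * (x ^ (-((1 : ℝ) / 4)) * x ^ ((3 : ℝ) / 4)) := by
          gcongr
      _ = (c₂ / 4) * ((16 / c₂) * (R ^ (2 : ℕ)) ^ (7 : ℕ) * (Real.log x + 1) * x ^ (-((1 : ℝ) / 4))) *
          x ^ ((3 : ℝ) / 4) := by
          field_simp; ring
      _ ≤ (c₂ / 4) * 1 * h := mul_le_mul (mul_le_mul_of_nonneg_left habs' (by positivity)) hx34h
          (by positivity) (by positivity)
      _ = c₂ / 4 * h := by ring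
  have hkey : (Nat.card G : ℝ) * (2 * Module.finrank ℚ K * Real.sqrt (x + h) * Real.log (x + h)) ≤
      c₂ / 4 * R ^ (-(8 : ℝ)) * h := by
    calc (Nat.card G : ℝ) * (2 * Module.finrank ℚ K * Real.sqrt (x + h) * Real.log (x + h))
        ≤ R ^ (4 : ℕ) * (2 * R * (2 * x ^ ((1 : ℝ) / 2)) * (Real.log x + 1)) := by
          refine mul_le_mul hG (mul_le_mul (mul_le_mul (by linarith) hsqrt (Real.sqrt_nonneg _) (by positivity))
            hlogxh hlog0 (by positivity)) (by positivity) (by positivity)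
      _ = 4 * R ^ (5 : ℕ) * (Real.log x + 1) * x ^ ((1 : ℝ) / 2) := by ring
      _ = (4 * R ^ (13 : ℕ) * (Real.log x + 1) * x ^ ((1 : ℝ) / 2)) * R ^ (-(8 : ℝ)) := by rw [hR5]; ring
      _ ≤ (c₂ / 4 * h) * R ^ (-(8 : ℝ)) := mul_le_mul_of_nonneg_right hA hRm8.le
      _ = c₂ / 4 * R ^ (-(8 : ℝ)) * h := by ring
  have hpp' := mul_le_mul_of_nonneg_left hpp hG0
  have hθψ' := mul_le_mul_of_nonneg_left hθψ hG0
  have hdeg' := mul_le_mul_of_nonneg_left hdeg hG0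
  have hGpos : (0 : ℝ) < (Nat.card G : ℝ) := by
    exact_mod_cast Nat.card_pos (α := G)
  -- `|G| (Δθ − junk) ≥ c₂ R^{-8} h − (c₂/4) R^{-8} h − (c₂/4) R^{-8} h > 0`
  have hgt : (Module.finrank ℚ K : ℝ) * (Real.sqrt (x + h) + 1) * Real.log (x + h) <
      fiberTheta 𝔪 f τ (x + h) - fiberTheta 𝔪 f τ x := by
    have h1 : 0 < c₂ / 2 * R ^ (-(8 : ℝ)) * h := by positivity
    have h2 : c₂ / 2 * R ^ (-(8 : ℝ)) * h ≤
        (Nat.card G : ℝ) * ((fiberTheta 𝔪 f τ (x + h) - fiberTheta 𝔪 f τ x) -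
          (Module.finrank ℚ K : ℝ) * (Real.sqrt (x + h) + 1) * Real.log (x + h)) := by
      nlinarith [hlow, hkey, hpp', hθψ', hdeg']
    have h3 := pos_of_mul_pos_right (lt_of_lt_of_le h1 h2) hGpos.le
    linarith
  exact exists_degOnePrime_of_fiberTheta_sub_gt τ hx0.le (by linarith) (by linarith) hgt

/-- **Hoheisel–Linnik for narrow ray classes with degree-one primes, unconditionally** (canonical case `G = Cl_K^𝔪`,
`f = primeRayClass`): for `n > 1` there are `δ, L > 0` such that for every number field `K` of degree `n`, every
`𝔪 ≠ 0`, every narrow ray class `τ mod 𝔪`, every `x ≥ (|d_K| n^n N𝔪)^L` and every `x^{1−δ} ≤ h ≤ x` there is a prime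
ideal `𝔭 ∤ 𝔪` in `τ` whose norm is a rational prime `p` with `x < p ≤ x + h`.  GRH-free, Siegel-free, no size
hypothesis. [cite: LagariasMontgomeryOdlyzko1979, §7] [cite: Weiss1983, §6] -/
theorem exists_degOnePrime_rayClass_absNorm_mem_Ioc (n : ℕ) (hn : 1 < n) :
    ∃ δ L : ℝ, 0 < δ ∧ 0 < L ∧ ∀ (K : Type) [Field K] [NumberField K], Module.finrank ℚ K = n →
    ∀ (𝔪 : Ideal (𝓞 K)) (h𝔪 : 𝔪 ≠ ⊥) (τ : RayClassGroup 𝔪),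
      ∀ x h : ℝ, rayCondQ K 𝔪 ^ L ≤ x → x ^ (1 - δ) ≤ h → h ≤ x →
      ∃ v : HeightOneSpectrum (𝓞 K), ¬ 𝔪 ≤ v.asIdeal ∧ primeRayClass 𝔪 h𝔪 v = τ ∧
        (Ideal.absNorm v.asIdeal).Prime ∧
        x < (Ideal.absNorm v.asIdeal : ℝ) ∧ (Ideal.absNorm v.asIdeal : ℝ) ≤ x + h := by
  obtain ⟨δ, L, hδ, hL, hmain⟩ := exists_degOnePrime_fiber_absNorm_mem_Ioc n hn
  refine ⟨δ, L, hδ, hL, fun K _ _ hKn 𝔪 h𝔪 τ x h hx hhx hhx' ↦ ?_⟩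
  haveI : Finite (RayClassGroup 𝔪) := finite_rayClassGroup h𝔪
  have hK : 1 < Module.finrank ℚ K := by rw [hKn]; exact hn
  exact hmain K hKn (RayClassGroup 𝔪) 𝔪 (primeRayClass 𝔪 h𝔪) h𝔪 (artinKillsRay_primeRayClass h𝔪)
    (fun χ hχ ↦ exists_charFun_primeRayClass_ne_one h𝔪 χ hχ) (natCard_rayClassGroup_le_rayCondQ_pow hK h𝔪)
    x h hx hhx hhx' τ

end Summit.QuantumAdvantage.QuantumAdvantage.Theorems.DegreeOnePrimesEscape

end
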